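import Mathlib
import Summits.NavierStokesRegularity.NavierStokesRegularity.Theorems.FilamentSkeletonRssDefectColumnGateAzimuthalBlockRotationFlux

/-!
# Route `FilamentSkeletonRss` · crux `TransverseReduction1AG` (stmt-NavierStokesRegularity-27853; A1L twin stmt-23297) · line
# `defect_column_gate_1AG/1AL` — the LAYER DISSIPATION lemma for the azimuthal blocks of S2a-loc `WaistColumnGateLoc1A`: Gaussian-weighted
# control of `u|w′|²` on an interior layer WITHOUT boundary fluxes (χ²-cut-off of the modulus flux) — brick (b1) of the two-zone assembly

Helper file (`--supports stmt-NavierStokesRegularity-27853 --as helper`; seat ns-filament-s2aloc-p1 g2; note ARCHITECTURE-B2B3-s2aloc-g2.md v3 §7,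
trap (T1)).  Built on `modulusFlux_weight_hasDerivAt` (`…AzimuthalBlockRotationFlux.lean`, p672794).

WHY.  In the two-zone scheme the truncation point `u₁` of the Gaussian core identities is chosen inside a layer `L = [p, q]` so that the boundary
fluxes `E(u₁)·4u₁·Im(w̄w′)(u₁)`, `2E(u₁)·u₁ s′(u₁)` are small; this needs the Gaussian-weighted layer dissipation `∫_L E u|w′|²`, which is NOT one of
the truncated currencies (it lives above `u₁`).  The present lemma supplies it with no boundary term at all: with the cut-off weight
`σ = E·χ²`, `χ = (u−p)(q−u)`, `E = e^{γu/4}`, the weight error of the modulus flux is `σ′ − γσ/4 = 2Eχχ′`, `σ(p) = σ(q) = 0`, and AM–GM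
`4|χχ′(a a′ + b b′)| ≤ χ²(a′²+b′²) + 4χ′²(a²+b²)` gives

`layer_dissipation_le`:  `∫_p^q E χ² u (a₁²+b₁²) ≤ (γ/2)∫_p^q E χ²(a²+b²) + ½∫_p^q E χ² |a f₁ + b f₂| + 4∫_p^q E χ′² u (a²+b²)`,

for the mode system with ANY rotation potential `V` and any forcing `f` (put the Biot–Savart term into `f`; on a layer above `u₀ = (4A/γ)log Rc` it is
`O(Rc^{1−A})`).  Every term on the right is an `E`-weighted `s`-integral on the layer or a forcing pairing — comparable POINTWISE IN THE WEIGHT with the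
rotation currency `Rc∫EΩs` (ratio `≲ 2πγ²q²/Rc`), which is what trap (T1) requires.
HONEST FRAMING: an identity-level estimate for ONE family of blocks of ONE linear MODEL operator of a hypothetical blow-up route (MODEL rung, negative
side); nothing here bears on NS regularity.
-/

set_option linter.dupNamespace false

noncomputable section

namespace Summit.NavierStokesRegularity.NavierStokesRegularity.Theorems.DefectColumnGate

open scoped Topology
open Set Filter MeasureTheory intervalIntegral

set_option maxHeartbeats 800000 in
/-- **Layer dissipation without boundary fluxes (χ²-cut-off).**  `0 < p < q`; on `[p,q]`: `a, b, a₁, b₁, f₁, f₂` continuous, `a′ = a₁`, `b′ = b₁`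
and the mode fluxes `(4u a₁ + γu a)′ = (m²/u)a − V b − f₁`, `(4u b₁ + γu b)′ = (m²/u)b + V a − f₂` on `(p,q)` (any `V`).  Then with
`χ = (u−p)(q−u)`, `χ′ = p + q − 2u`, `E = e^{γu/4}`:
`∫_p^q Eχ²u(a₁²+b₁²) ≤ (γ/2)∫_p^q Eχ²(a²+b²) + ½∫_p^q Eχ²|a f₁ + b f₂| + 4∫_p^q Eχ′²u(a²+b²)`. -/
theorem layer_dissipation_le {γ m p q : ℝ} {a a₁ b b₁ f₁ f₂ V : ℝ → ℝ} (hp : 0 < p) (hpq : p < q)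
    (ha : ContinuousOn a (Icc p q)) (hb : ContinuousOn b (Icc p q))
    (ha₁ : ContinuousOn a₁ (Icc p q)) (hb₁ : ContinuousOn b₁ (Icc p q))
    (hf₁ : ContinuousOn f₁ (Icc p q)) (hf₂ : ContinuousOn f₂ (Icc p q))
    (hdera : ∀ u ∈ Ioo p q, HasDerivAt a (a₁ u) u) (hderb : ∀ u ∈ Ioo p q, HasDerivAt b (b₁ u) u)
    (hΦa : ∀ u ∈ Ioo p q,
      HasDerivAt (fun s => 4 * s * a₁ s + γ * s * a s) (m ^ 2 / u * a u - V u * b u - f₁ u) u)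
    (hΦb : ∀ u ∈ Ioo p q,
      HasDerivAt (fun s => 4 * s * b₁ s + γ * s * b s) (m ^ 2 / u * b u + V u * a u - f₂ u) u) :
    ∫ u in p..q, Real.exp (γ * u / 4) * ((u - p) * (q - u)) ^ 2 * (u * (a₁ u ^ 2 + b₁ u ^ 2))
      ≤ γ / 2 * (∫ u in p..q, Real.exp (γ * u / 4) * ((u - p) * (q - u)) ^ 2 * (a u ^ 2 + b u ^ 2))
        + 1 / 2 * (∫ u in p..q, Real.exp (γ * u / 4) * ((u - p) * (q - u)) ^ 2 * |a u * f₁ u + b u * f₂ u|)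
        + 4 * (∫ u in p..q, Real.exp (γ * u / 4) * (p + q - 2 * u) ^ 2 * (u * (a u ^ 2 + b u ^ 2))) := by
  have hpq' : p ≤ q := hpq.le
  -- the cut-off weight and its derivative
  set χ : ℝ → ℝ := fun u => (u - p) * (q - u) with hχdef
  set E : ℝ → ℝ := fun u => Real.exp (γ * u / 4) with hEdef
  set σ : ℝ → ℝ := fun u => E u * χ u ^ 2 with hσdef
  have hχ' : ∀ u, HasDerivAt χ (p + q - 2 * u) u := by
    intro u
    have h := ((hasDerivAt_id' u).sub_const p).mul ((hasDerivAt_const u q).sub (hasDerivAt_id' u))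
    exact h.congr_deriv (by simp; ring)
  have hE' : ∀ u, HasDerivAt E (E u * (γ / 4)) u := by
    intro u
    have h1 : HasDerivAt (fun s : ℝ => γ * s / 4) (γ / 4) u := by
      simpa using ((hasDerivAt_id' u).const_mul γ).div_const 4
    exact h1.exp
  have hσ' : ∀ u, HasDerivAt σ (E u * (γ / 4) * χ u ^ 2 + E u * (2 * χ u * (p + q - 2 * u))) u := by
    intro u
    have h := (hE' u).mul ((hχ' u).fun_pow 2)
    exact h.congr_deriv (by simp)
  -- continuity / integrability on `[p, q]`
  have hEc : ContinuousOn E (Icc p q) := (Real.continuous_exp.comp (by continuity)).continuousOn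
  have hχc : ContinuousOn χ (Icc p q) := by
    simp only [hχdef]; exact (continuousOn_id.sub continuousOn_const).mul (continuousOn_const.sub continuousOn_id)
  have hσc : ContinuousOn σ (Icc p q) := hEc.mul (hχc.pow 2)
  have hΦac : ContinuousOn (fun s => 4 * s * a₁ s + γ * s * a s) (Icc p q) :=
    ((continuousOn_const.mul continuousOn_id).mul ha₁).add ((continuousOn_const.mul continuousOn_id).mul ha)
  have hΦbc : ContinuousOn (fun s => 4 * s * b₁ s + γ * s * b s) (Icc p q) :=
    ((continuousOn_const.mul continuousOn_id).mul hb₁).add ((continuousOn_const.mul continuousOn_id).mul hb)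
  have hSc : ContinuousOn (fun s => a s ^ 2 + b s ^ 2) (Icc p q) := (ha.pow 2).add (hb.pow 2)
  have hFc : ContinuousOn (fun s => σ s * ((a s * (4 * s * a₁ s + γ * s * a s) + b s * (4 * s * b₁ s + γ * s * b s)
      - γ * s * (a s ^ 2 + b s ^ 2)) / 2)) (Icc p q) :=
    hσc.mul ((((ha.mul hΦac).add (hb.mul hΦbc)).sub ((continuousOn_const.mul continuousOn_id).mul hSc)).div_const 2)
  -- the derivative of `σ·Y`
  set dF : ℝ → ℝ := fun u => σ u * (4 * u * (a₁ u ^ 2 + b₁ u ^ 2) + (m ^ 2 / u - γ) * (a u ^ 2 + b u ^ 2)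
      - (a u * f₁ u + b u * f₂ u)) / 2
      + 2 * u * (a u * a₁ u + b u * b₁ u) * ((E u * (γ / 4) * χ u ^ 2 + E u * (2 * χ u * (p + q - 2 * u))) - γ * σ u / 4) with hdFdef
  have hderiv : ∀ u ∈ Ioo p q, HasDerivAt (fun s => σ s * ((a s * (4 * s * a₁ s + γ * s * a s)
      + b s * (4 * s * b₁ s + γ * s * b s) - γ * s * (a s ^ 2 + b s ^ 2)) / 2)) (dF u) u :=
    fun u hu => modulusFlux_weight_hasDerivAt (hσ' u) (hdera u hu) (hderb u hu) (hΦa u hu) (hΦb u hu)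
  have hdFc : ContinuousOn dF (Icc p q) := by
    have hinv : ContinuousOn (fun u : ℝ => m ^ 2 / u - γ) (Icc p q) :=
      (continuousOn_const.div continuousOn_id (fun u hu => (lt_of_lt_of_le hp hu.1).ne')).sub continuousOn_const
    simp only [hdFdef]
    apply ContinuousOn.add
    · exact (hσc.mul ((((continuousOn_const.mul continuousOn_id).mul ((ha₁.pow 2).add (hb₁.pow 2))).add
        (hinv.mul hSc)).sub ((ha.mul hf₁).add (hb.mul hf₂)))).div_const 2
    · exact ((continuousOn_const.mul continuousOn_id).mul ((ha.mul ha₁).add (hb.mul hb₁))).mul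
        (((hEc.mul continuousOn_const).mul (hχc.pow 2)).add (hEc.mul ((continuousOn_const.mul hχc).mul
          (continuousOn_const.sub (continuousOn_const.mul continuousOn_id))))
        |>.sub ((continuousOn_const.mul hσc).div_const 4))
  have hdFi : IntervalIntegrable dF volume p q := hdFc.intervalIntegrable_of_Icc hpq'
  have hFTC := integral_eq_sub_of_hasDerivAt_of_le hpq' hFc hderiv hdFi
  have hσp : σ p = 0 := by simp [hσdef, hχdef]
  have hσq : σ q = 0 := by simp [hσdef, hχdef]
  rw [hσp, hσq] at hFTC
  simp only [zero_mul, sub_zero] at hFTC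
  -- `∫ dF = 0`; rewrite `dF` pointwise
  have hdF_eq : ∀ u ∈ Icc p q, dF u = E u * χ u ^ 2 * (2 * u * (a₁ u ^ 2 + b₁ u ^ 2))
      + E u * χ u ^ 2 * ((m ^ 2 / u - γ) * (a u ^ 2 + b u ^ 2)) / 2
      - E u * χ u ^ 2 * (a u * f₁ u + b u * f₂ u) / 2
      + 4 * E u * χ u * (p + q - 2 * u) * (u * (a u * a₁ u + b u * b₁ u)) := by
    intro u _
    simp only [hdFdef, hσdef]
    ring
  -- pointwise lower bound of `dF` by the quantities in the statement
  have hpt : ∀ u ∈ Icc p q,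
      E u * χ u ^ 2 * (u * (a₁ u ^ 2 + b₁ u ^ 2))
        - γ / 2 * (E u * χ u ^ 2 * (a u ^ 2 + b u ^ 2))
        - 1 / 2 * (E u * χ u ^ 2 * |a u * f₁ u + b u * f₂ u|)
        - 4 * (E u * (p + q - 2 * u) ^ 2 * (u * (a u ^ 2 + b u ^ 2))) ≤ dF u := by
    intro u hu
    rw [hdF_eq u hu]
    have hu0 : 0 < u := lt_of_lt_of_le hp hu.1
    have hE0 : 0 < E u := Real.exp_pos _
    have hχ2 : 0 ≤ χ u ^ 2 := sq_nonneg _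
    -- the `m²/u` term is nonnegative
    have h1 : 0 ≤ E u * χ u ^ 2 * (m ^ 2 / u * (a u ^ 2 + b u ^ 2)) / 2 := by positivity
    -- the forcing term
    have h2 : -(E u * χ u ^ 2 * |a u * f₁ u + b u * f₂ u|) ≤ -(E u * χ u ^ 2 * (a u * f₁ u + b u * f₂ u)) := by
      have := le_abs_self (a u * f₁ u + b u * f₂ u)
      nlinarith [mul_nonneg hE0.le hχ2]
    -- AM–GM for the cross term: `4|χχ′(aa₁+bb₁)| ≤ χ²(a₁²+b₁²) + 4χ′²(a²+b²)`
    have h3 : -(4 * E u * χ u * (p + q - 2 * u) * (u * (a u * a₁ u + b u * b₁ u)))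
        ≤ E u * (u * (χ u ^ 2 * (a₁ u ^ 2 + b₁ u ^ 2) + 4 * (p + q - 2 * u) ^ 2 * (a u ^ 2 + b u ^ 2))) := by
      have k : 0 ≤ (χ u * a₁ u + 2 * (p + q - 2 * u) * a u) ^ 2 + (χ u * b₁ u + 2 * (p + q - 2 * u) * b u) ^ 2 := by
        positivity
      have hEu : 0 ≤ E u * u := by positivity
      nlinarith [mul_nonneg hEu k]
    nlinarith [h1, h2, h3]
  -- integrate the pointwise bound
  have hIcont₁ : ContinuousOn (fun u => E u * χ u ^ 2 * (u * (a₁ u ^ 2 + b₁ u ^ 2))) (Icc p q) :=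
    (hEc.mul (hχc.pow 2)).mul (continuousOn_id.mul ((ha₁.pow 2).add (hb₁.pow 2)))
  have hIcont₂ : ContinuousOn (fun u => E u * χ u ^ 2 * (a u ^ 2 + b u ^ 2)) (Icc p q) := (hEc.mul (hχc.pow 2)).mul hSc
  have hIcont₃ : ContinuousOn (fun u => E u * χ u ^ 2 * |a u * f₁ u + b u * f₂ u|) (Icc p q) :=
    (hEc.mul (hχc.pow 2)).mul ((ha.mul hf₁).add (hb.mul hf₂)).abs
  have hIcont₄ : ContinuousOn (fun u => E u * (p + q - 2 * u) ^ 2 * (u * (a u ^ 2 + b u ^ 2))) (Icc p q) :=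
    (hEc.mul ((continuousOn_const.sub (continuousOn_const.mul continuousOn_id)).pow 2)).mul (continuousOn_id.mul hSc)
  have hI₁ : IntervalIntegrable (fun u => E u * χ u ^ 2 * (u * (a₁ u ^ 2 + b₁ u ^ 2))) volume p q :=
    hIcont₁.intervalIntegrable_of_Icc hpq'
  have hI₂ : IntervalIntegrable (fun u => E u * χ u ^ 2 * (a u ^ 2 + b u ^ 2)) volume p q :=
    hIcont₂.intervalIntegrable_of_Icc hpq'
  have hI₃ : IntervalIntegrable (fun u => E u * χ u ^ 2 * |a u * f₁ u + b u * f₂ u|) volume p q :=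
    hIcont₃.intervalIntegrable_of_Icc hpq'
  have hI₄ : IntervalIntegrable (fun u => E u * (p + q - 2 * u) ^ 2 * (u * (a u ^ 2 + b u ^ 2))) volume p q :=
    hIcont₄.intervalIntegrable_of_Icc hpq'
  have hmono : ∫ u in p..q, (E u * χ u ^ 2 * (u * (a₁ u ^ 2 + b₁ u ^ 2))
        - γ / 2 * (E u * χ u ^ 2 * (a u ^ 2 + b u ^ 2))
        - 1 / 2 * (E u * χ u ^ 2 * |a u * f₁ u + b u * f₂ u|)
        - 4 * (E u * (p + q - 2 * u) ^ 2 * (u * (a u ^ 2 + b u ^ 2)))) ≤ ∫ u in p..q, dF u :=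
    integral_mono_on hpq' (((hI₁.sub (hI₂.const_mul _)).sub (hI₃.const_mul _)).sub (hI₄.const_mul _))
      hdFi hpt
  rw [hFTC] at hmono
  rw [integral_sub ((hI₁.sub (hI₂.const_mul _)).sub (hI₃.const_mul _)) (hI₄.const_mul _),
    integral_sub (hI₁.sub (hI₂.const_mul _)) (hI₃.const_mul _), integral_sub hI₁ (hI₂.const_mul _),
    intervalIntegral.integral_const_mul, intervalIntegral.integral_const_mul, intervalIntegral.integral_const_mul] at hmono
  simp only [hEdef, hχdef] at hmono
  linarith

end Summit.NavierStokesRegularity.NavierStokesRegularity.Theorems.DefectColumnGate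

end
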